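import Literature.Computability.AlgebraicComplexity.PencilRankDiagonalizablePerturbation
import Mathlib.Tactic.NoncommRing
import Mathlib.Data.ZMod.Basic
import HarnessLib

/-!
# `rank_{GF(2)}(E₃; A) ≥ 5`: the field-size hypothesis in Ja'Ja''s upper bound cannot be removed
# (Sumi–Miyazaki–Sakata 2009, Prop. 18)

Topic `Literature/Computability/AlgebraicComplexity` (bilinear complexity; rank of matrix pencils).
Sequel to `PencilRankDiagonalizablePerturbation.lean` (`exists_card_add_rank_sub_le_tensorRank`:
`R(XI + YA) ≥ m + rk(A − D)` for a suitable `D = P·diag d·P⁻¹`) and `PencilRankCompanionBlock.lean`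
(BCS Prop. (19.8): `R(𝔉_p) ≤ n + 1` when `|k| ≥ n`). Source: T. Sumi, M. Miyazaki, T. Sakata,
*Rank of 3-tensors with 2 slices and Kronecker canonical forms*, LAA 431 (2009), arXiv:0808.1167
(held text `paper:arxiv-0808.1167`, read 2026-08-27), p. 6: "The following example shows that
Theorem 17 does not hold over the Galois field `GF(2)` and thus the condition
`card(𝕂) ≥ deg p₁(A)` can not be removed in Theorem 17. **Proposition 18.** For
`A = (0 0 1; 1 0 1; 0 1 0)`, it holds that `rank_{GF(2)}(E₃; A) ≥ 5`."

## What is proved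

* **`SumiMiyazakiSakata2008_prop_18`** — `5 ≤ R(XI₃ + YA)` over `ZMod 2` for the printed `A`
  (`p_A = x³ + x + 1`; over any field with `≥ 3` elements every pencil `XI₃ + YF_p`, `p` cubic, has
  rank `≤ 4` by BCS Prop. (19.8), `tensorRank_companionPencil_le_succ`). Proof (ours,
  shorter than the printed decomposition argument, via the rank-distance lemma): `R ≥ 3 + rk(A − D)`
  with `D = P·diag d·P⁻¹` idempotent over `GF(2)`; if `R := A − D` had rank `≤ 1`, then
  `A² − A = (D − 1)R + RA` would have rank `≤ 2`, whereas `A(A − 1)` is invertible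
  (`det A = det(A − 1) = 1`, `SumiMiyazakiSakata2008_prop_18_matrix_det`).

Theorem-only file: no definitions, no named facts.

## References

* [SumiMiyazakiSakata2008] T. Sumi, M. Miyazaki, T. Sakata, *Rank of 3-tensors with 2 slices and
  Kronecker canonical forms*, LAA 431 (2009) 1858–1868, arXiv:0808.1167 — Prop. 18 (p. 6 of the
  arXiv text), Thm. 17.
* [BurgisserClausenShokrollahi1997] P. Bürgisser, M. Clausen, M. A. Shokrollahi, *Algebraic
  Complexity Theory*, Springer 1997 — Prop. (19.8), Ex. 19.11 (hypothesis "`k` has at least `n`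
  elements").
-/

noncomputable section

open scoped BigOperators
open Module Finset Matrix

namespace Literature.Computability.AlgebraicComplexity

namespace MatrixPencil

section PartTwentyOne

/-! ### Sumi–Miyazaki–Sakata Prop. 18: over `GF(2)` the field-size hypothesis of Ja'Ja''s
upper bound (BCS Prop. (19.8): `|k| ≥ n`) cannot be removed -/

/-- Subadditivity of the matrix rank. [folklore] -/
private theorem rank_add_le' {K : Type*} [Field K] {m n : Type*} [Fintype m] [Fintype n]
    [DecidableEq n] (M N : Matrix m n K) : (M + N).rank ≤ M.rank + N.rank := by
  unfold Matrix.rank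
  rw [Matrix.mulVecLin_add]
  exact (Submodule.finrank_mono (LinearMap.range_add_le _ _)).trans
    (Submodule.finrank_add_le_finrank_add_finrank _ _)

/-- The matrix `A` of [SumiMiyazakiSakata2008, Prop. 18] (`p_A = x³ + x + 1`, irreducible over
`GF(2)`). [cite: SumiMiyazakiSakata2008, Prop. 18] -/
theorem SumiMiyazakiSakata2008_prop_18_matrix_det :
    (!![0, 0, 1; 1, 0, 1; 0, 1, 0] : Matrix (Fin 3) (Fin 3) (ZMod 2)).det = 1 ∧
      ((!![0, 0, 1; 1, 0, 1; 0, 1, 0] : Matrix (Fin 3) (Fin 3) (ZMod 2)) - 1).det = 1 := by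
  constructor
  · simp [Matrix.det_fin_three]
  · rw [Matrix.det_fin_three]
    decide

/-- **[SMS 2009, Prop. 18]: `rank_{GF(2)}(E₃; A) ≥ 5` for `A = !![0,0,1; 1,0,1; 0,1,0]`** — so
Ja'Ja''s bound `rank_𝕂(E_n; A) ≤ n + k` (Thm. 17 there; BCS Prop. (19.8) `R(𝔉_p) ≤ n + 1` for
`|k| ≥ n`) fails over `GF(2)` ("the condition `card(𝕂) ≥ deg p₁(A)` can not be removed"). The
printed proof argues on a length-`4` decomposition directly; here: by
`exists_card_add_rank_sub_le_tensorRank`, `R ≥ 3 + rk(A − D)` for some `D = P·diag d·P⁻¹`, which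
over `GF(2)` is idempotent; if `R := A − D` had rank `≤ 1` then
`A² − A = (D − 1)R + RA` would have rank `≤ 2`, but `A(A − 1)` is invertible.
[cite: SumiMiyazakiSakata2008, Prop. 18] -/
theorem SumiMiyazakiSakata2008_prop_18 :
    5 ≤ tensorRank (pencilTensor (1 : Matrix (Fin 3) (Fin 3) (ZMod 2)) !![0, 0, 1; 1, 0, 1; 0, 1, 0]) := by
  classical
  set A : Matrix (Fin 3) (Fin 3) (ZMod 2) := !![0, 0, 1; 1, 0, 1; 0, 1, 0] with hA
  obtain ⟨P, d, hP, hle⟩ := exists_card_add_rank_sub_le_tensorRank A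
  rw [Fintype.card_fin] at hle
  set D := P * diagonal d * P⁻¹ with hD
  -- `D` is idempotent (`d i ∈ GF(2)`)
  have hd2 : (fun i => d i * d i) = d := by
    funext i
    have : ∀ x : ZMod 2, x * x = x := by decide
    exact this (d i)
  have hD2 : D * D = D := by
    have h1 : P⁻¹ * (P * diagonal d * P⁻¹) = diagonal d * P⁻¹ := by
      rw [← Matrix.mul_assoc, ← Matrix.mul_assoc, Matrix.nonsing_inv_mul P hP, Matrix.one_mul]
    rw [hD, Matrix.mul_assoc (P * diagonal d) P⁻¹ (P * diagonal d * P⁻¹), h1,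
      Matrix.mul_assoc P (diagonal d) (diagonal d * P⁻¹), ← Matrix.mul_assoc (diagonal d) (diagonal d) P⁻¹,
      diagonal_mul_diagonal, hd2, ← Matrix.mul_assoc]
  -- if `rk(A − D) ≤ 1`: contradiction
  suffices h2 : 2 ≤ (A - D).rank by omega
  by_contra hlt
  rw [not_le] at hlt
  have hR : (A - D).rank ≤ 1 := by omega
  set R := A - D with hR'
  have hkey : A * A - A = (D - 1) * R + R * A := by
    have h1 : (D - 1) * (A - D) + (A - D) * A = A * A - A + (D - D * D) := by noncomm_ring
    rw [hR', h1, hD2, sub_self, add_zero]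
  have hrank_le : (A * A - A).rank ≤ 2 := by
    rw [hkey]
    refine (rank_add_le' _ _).trans ?_
    have h1 : ((D - 1) * R).rank ≤ 1 := (Matrix.rank_mul_le_right _ _).trans hR
    have h2 : (R * A).rank ≤ 1 := (Matrix.rank_mul_le_left _ _).trans hR
    omega
  have hunit : IsUnit (A * A - A) := by
    rw [show A * A - A = A * (A - 1) by noncomm_ring, Matrix.isUnit_iff_isUnit_det, Matrix.det_mul,
      SumiMiyazakiSakata2008_prop_18_matrix_det.1, SumiMiyazakiSakata2008_prop_18_matrix_det.2,
      mul_one]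
    exact isUnit_one
  have hrank3 : (A * A - A).rank = 3 := by
    rw [Matrix.rank_of_isUnit _ hunit, Fintype.card_fin]
  omega

end PartTwentyOne

end MatrixPencil

end Literature.Computability.AlgebraicComplexity

end
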